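import Summits.HodgeConjecture.HodgeConjecture.Theorems.K2E3U2PrincipalSeriesNoThreeChain   -- ★ (K2E3-p26) `not_bot_lt_lt_lt_top_cmPrincipalSeries_two`: `i_G(χ)` on `U(Φ₂)(L⁺_v)` has NO chain `⊥ < N₁ < N₂ < ⊤` (non-split `v`, every `χ`); brings `isSmooth_cmPrincipalSeries`
import Summits.HodgeConjecture.HodgeConjecture.Theorems.R90S4HLdsOfKeys                      -- ★ p861828 (this seat): `stub_R90_S4_H_lds_of_two_of_orbit` ((STAB), (ADM) discharged)
import Literature.NumberTheory.Automorphic.ConstituentsOfExtension                           -- ★ no 3-chains ⇒ `ρ|_N`, `ρ⁄N` irreducible and `JH(ρ) = {⟦ρ⁄N⟧, ⟦ρ|_N⟧}`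
import HarnessLib

/-!
# R90-TF · S4 «Ch. 13.1–2» — socket S4#B5 `stub_R90_S4_H_lds`: the input (TWO) «`JH(i_G(χ))` has exactly two elements» CUT TO
# (RED) «`i_G(χ)` is reducible» + (DIST) «its irreducible sub and quotient are inequivalent» (length ≤ 2 on `U(1,1)` is ★)

Cell `hodgecm-mathlib`, crux H413 (`stmt-HodgeConjecture-24833`, lane `--supports … --as helper`), route of record `HCCMUnconditional`
(no route verbs; count-neutral).  Programme R90-TF (HUMAN RULING «R90-TF SLAB — MAX PUSH»; brief `director/R90-BRIEF.v2.md`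
1f40d54518340a35), section S4 = Rogawski Ch. 13.1–2 (base `R90-C131`); seat R90-C131-p05 (g0), socket S4#B5 dealt BY NAME
(`R90/S4/DEAL-S4-WAVE1.K2E2-plan-g6.md`).  THEOREMS ONLY (no `def`, no instance, no notation, no named fact, no `sorry`); imports ★ only.

THE POINT.  ★ `R90S4HLdsOfKeys` (p861828) reduced S4#B5 to (TWO) + (ORBIT).  The tree ALREADY proves Casselman's Cor. 7.1.2 for the rank-one
quasi-split `U(Φ₂)(L⁺_v) ≅ U(1,1)` at a non-split place — ★ `K2E3U2PrincipalSeriesNoThreeChain.not_bot_lt_lt_lt_top_cmPrincipalSeries_two` (K2E3-p26, Track B, over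
★ `dim r_B i_G(χ) ≤ 2`, ★ Harish-Chandra's criterion (HC₂) and ★ the strict monotonicity of the Jacquet rank): `i_G(χ) = cmPrincipalSeries L 2 v χ` has no chain
`⊥ < N₁ < N₂ < ⊤` of subrepresentations, for EVERY character `χ` of the diagonal torus.  Hence (★ `ConstituentsOfExtension`) for any proper non-zero
subrepresentation `N`, both `i_G(χ)|_N` and `i_G(χ) ⁄ N` are irreducible and `JH(i_G(χ)) = {⟦i_G(χ) ⁄ N⟧, ⟦i_G(χ)|_N⟧}`.  So (TWO) — «there are `π₁ ≠ π₂` with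
`JH(i_G(χ)) = {π₁, π₂}`» — follows from the two genuinely analytic statements
* (RED)  `i_G(χ)` is REDUCIBLE: a subrepresentation `⊥ ≠ N ≠ ⊤` exists [Rogawski1990, §11.1 p. 161 case 2): `χ₁|F^× = ω_{E/F}`; the normalised intertwining
  operator at the unitary point `wχ = χ` is not a scalar — Keys–Shahidi], and
* (DIST) `i_G(χ)|_N ≇ i_G(χ) ⁄ N` [ibid. «`JH(i_G(χ))` has two elements», i.e. two DISTINCT classes; for unitary `χ` it is `i_G(χ) = π⁺ ⊕ π⁻` with `π⁺ ≇ π⁻` by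
  `dim End_G i_G(χ) ≤ dim r_B i_G(χ) = 2` (Frobenius reciprocity)],
read here as ONE hypothesis `∃ N, N ≠ ⊥ ∧ N ≠ ⊤ ∧ IsEmpty (N.toRepresentation.Equiv N.quotientRep)` on `cmPrincipalSeries L 2 v χ`:
* `two_of_exists_sub_not_equiv_quot` — (TWO) at `(L, v, χ)` from that hypothesis (non-split `v`, any `χ`), with `π₁ = ⟦i_G(χ) ⁄ N⟧`, `π₂ = ⟦i_G(χ)|_N⟧`;
* `stub_R90_S4_H_lds_of_reducibleSplit_of_orbit` — S4#B5's statement (B's defs unfolded, as in ★ `stub_R90_S4_H_lds_of_two_of_orbit`) from (RED)+(DIST) and (ORBIT)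
  under the socket's guards.
The by-import probe at HOME (`R90/R90-C131-p05/g0/probe_lds_byimport.lean`) certifies the conclusion is the socket's type token for token.

HONEST LABEL: HC_CM is proved only modulo the 7 printed citations (2 remaining named inputs: hLiu418 = stmt-HodgeConjecture-24832,
h413 = stmt-HodgeConjecture-24833) until rung 0 closes; this file CLOSES NOTHING by itself — (RED), (DIST), (ORBIT) are printed p-adic facts of
[Rogawski1990, §11.1 p. 161] not in the tree.  REL ≠ ★ ≠ BUILT.

## References
* [Rogawski1990] J. D. Rogawski, *Automorphic Representations of Unitary Groups in Three Variables*, Ann. of Math. Stud. 123 (1990), §11.1 p. 161,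
  §12.1 pp. 171–172, §12.2 p. 173 («exactly two irreducible constituents ([BZ])»).
* [Casselman1995] W. Casselman, *Introduction to the theory of admissible representations of 𝔭-adic reductive groups* (1995), Cor. 7.1.2 p. 67.
* [LabesseLanglands1979] J.-P. Labesse, R. P. Langlands, *L-indistinguishability for SL(2)*, Canad. J. Math. 31 (1979), 726–785.
* [BushnellHenniart2006] C. J. Bushnell, G. Henniart, *The Local Langlands Conjecture for GL(2)* (2006), §1.1–§2.
-/

set_option autoImplicit false
-- the mandated namespace (brief §3.4) repeats the single-problem summit's segment (`HodgeConjecture.HodgeConjecture`)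
set_option linter.dupNamespace false

noncomputable section

open NumberField IsDedekindDomain
open scoped MatrixGroups
open Literature.NumberTheory.Automorphic Literature.NumberTheory.Automorphic.UnitaryGroup

namespace Summit.HodgeConjecture.HodgeConjecture.R90.S4

set_option synthInstance.maxHeartbeats 400000 in  -- instance paths on the CM carrier `∏_{w ∣ v} L_w` (as ★ `not_bot_lt_lt_lt_top_cmPrincipalSeries_two`)
set_option maxHeartbeats 1600000 in  -- statement-heavy: `Subrepresentation (cmPrincipalSeries …)`, `IsConstituentOf (cmPrincipalSeries …)` on both carrier spellings (as ★ `reducible_cut_cmPrincipalSeries_two`)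
/-- **(TWO) ⟸ (RED) + (DIST) on `U(Φ₂)(L⁺_v)`, `v` non-split, every `χ`.**  If `i_G(χ) = cmPrincipalSeries L 2 v χ` has a subrepresentation `N` with `⊥ ≠ N ≠ ⊤`
(REDUCIBLE) whose irreducible sub and quotient are INEQUIVALENT (`i_G(χ)|_N ≇ i_G(χ) ⁄ N`), then `JH(i_G(χ))` consists of exactly two classes `π₁ ≠ π₂`
(`π₁ = ⟦i_G(χ) ⁄ N⟧`, `π₂ = ⟦i_G(χ)|_N⟧`): no 3-chains (★ `not_bot_lt_lt_lt_top_cmPrincipalSeries_two`) make `i_G(χ)|_N`, `i_G(χ) ⁄ N` irreducible (★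
`IrrClass.isIrreducible_toRepresentation_of_forall_not_lt_lt`, ★ `…_quotientRep_…`) and `JH = {⟦i_G(χ) ⁄ N⟧, ⟦i_G(χ)|_N⟧}` (★ `IrrClass.isConstituentOf_iff_of_isIrreducible`).
The conclusion is the input `hTwo` of ★ `lds_of_two_of_orbit` at `(L, v, χ)`, on B's carrier `(cmDatum L 2 Φ₂).Local v` (`cmDatum_Local_eq` is `rfl`).
[cite: Rogawski1990, §11.1 p. 161; §12.2 p. 173] [cite: Casselman1995, Cor. 7.1.2 p. 67] -/
theorem two_of_exists_sub_not_equiv_quot (L : Type) [Field L] [NumberField L] [IsCMField L]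
    (v : HeightOneSpectrum (𝓞 ↥(maximalRealSubfield L))) (hns : ∀ w : PlacesOver L v, IsCMField.complexConj L • w.1 = w.1)
    (χ : ↥(torusU (conjLocal L (IsCMField.complexConj L) v) (cmLocalForm L 2 v)) →* ℂˣ)
    (hN : ∃ N : Subrepresentation (cmPrincipalSeries L 2 v χ), N ≠ ⊥ ∧ N ≠ ⊤ ∧ IsEmpty (N.toRepresentation.Equiv N.quotientRep)) :
    ∃ π₁ π₂ : IrrClass ((cmDatum L 2 (Matrix.of fun i j : Fin 2 => if i.val + j.val + 1 = 2 then (1 : L) else 0)).Local v),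
      π₁ ≠ π₂ ∧ ∀ c, c.IsConstituentOf (cmPrincipalSeries L 2 v χ) ↔ c = π₁ ∨ c = π₂ := by
  obtain ⟨N, hb, ht, hne⟩ := hN
  haveI := locallyCompactSpace_cmBorelU L 2 v
  have hlen := Cruxes.H413.K2E3U2PrincipalSeriesNoThreeChain.not_bot_lt_lt_lt_top_cmPrincipalSeries_two L v hns χ
  have hsm : (cmPrincipalSeries L 2 v χ).IsSmooth := Cruxes.H413.K2E3LocalIrrepCuspidalOrPrincipalTwo.isSmooth_cmPrincipalSeries L 2 v χ
  have hNirr := IrrClass.isIrreducible_toRepresentation_of_forall_not_lt_lt hlen hb ht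
  have hQirr := IrrClass.isIrreducible_quotientRep_of_forall_not_lt_lt hlen hb ht
  have hJH := IrrClass.isConstituentOf_iff_of_isIrreducible hsm N hNirr hQirr
  refine ⟨IrrClass.mk (SmoothIrrep.mk (_ ⧸ N.toSubmodule) N.quotientRep hQirr (hsm.quotientRep N)),
    IrrClass.mk (SmoothIrrep.mk ↥N.toSubmodule N.toRepresentation hNirr (hsm.toRepresentation N)), fun h => ?_, hJH⟩
  obtain ⟨e⟩ := (IrrClass.mk_eq_mk_iff _ _).1 h
  exact hne.false e.symm

set_option synthInstance.maxHeartbeats 400000 in  -- as above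
set_option maxHeartbeats 1600000 in  -- statement-heavy composition (two `Subrepresentation (cmPrincipalSeries …)` binders); no search
/-- **SOCKET S4#B5 `stub_R90_S4_H_lds` FROM (RED)+(DIST) AND (ORBIT)**, under the socket's own binders and guards: at a non-split `v`, for smooth `χ₁, χ₂` with
`χ₁|F_v^× = ω_{E/F}`, IF `i_G((χ₁, χ₂))` has a subrepresentation `⊥ ≠ N ≠ ⊤` with `i_G|_N ≇ i_G ⁄ N` [§11.1 p. 161 case 2): reducible with two DISTINCT constituents] and
any two constituents are similitude-conjugate [ibid., «l.d.s. L-packet» = one `PGL₂(F)`-orbit], THEN the socket's statement (B's `U2Loc ∕ IsRogPacketU2 ∕ IsU2SimilConj`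
unfolded; ★ `stub_R90_S4_H_lds_of_two_of_orbit` ∘ `two_of_exists_sub_not_equiv_quot`). [cite: Rogawski1990, §11.1 p. 161; §12.1 p. 171] [cite: Casselman1995, Cor. 7.1.2 p. 67] -/
theorem stub_R90_S4_H_lds_of_reducibleSplit_of_orbit
    (hRed : ∀ (L : Type) [Field L] [NumberField L] [IsCMField L] (v : HeightOneSpectrum (𝓞 ↥(maximalRealSubfield L))),
      (∀ w : PlacesOver L v, IsCMField.complexConj L • w.1 = w.1) →
      ∀ (χ₁ : (LocalRing L v)ˣ →* ℂˣ) (χ₂ : ↥(normOneUnits (conjLocal L (IsCMField.complexConj L) v)) →* ℂˣ),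
        IsOpen ((χ₁.ker : Subgroup (LocalRing L v)ˣ) : Set (LocalRing L v)ˣ) →
        IsOpen ((χ₂.ker : Subgroup ↥(normOneUnits (conjLocal L (IsCMField.complexConj L) v))) :
          Set ↥(normOneUnits (conjLocal L (IsCMField.complexConj L) v))) →
        IsQuadraticCharExtension (conjLocal L (IsCMField.complexConj L) v) χ₁ →
        ∃ N : Subrepresentation (cmPrincipalSeries L 2 v
            (torusCharPair (conjLocal L (IsCMField.complexConj L) v) (cmLocalForm L 2 v) (cmLocalForm_eq_over L 2 v) 0 χ₁ χ₂)),
          N ≠ ⊥ ∧ N ≠ ⊤ ∧ IsEmpty (N.toRepresentation.Equiv N.quotientRep))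
    (hOrbit : ∀ (L : Type) [Field L] [NumberField L] [IsCMField L] (v : HeightOneSpectrum (𝓞 ↥(maximalRealSubfield L))),
      (∀ w : PlacesOver L v, IsCMField.complexConj L • w.1 = w.1) →
      ∀ (χ₁ : (LocalRing L v)ˣ →* ℂˣ) (χ₂ : ↥(normOneUnits (conjLocal L (IsCMField.complexConj L) v)) →* ℂˣ),
        IsOpen ((χ₁.ker : Subgroup (LocalRing L v)ˣ) : Set (LocalRing L v)ˣ) →
        IsOpen ((χ₂.ker : Subgroup ↥(normOneUnits (conjLocal L (IsCMField.complexConj L) v))) :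
          Set ↥(normOneUnits (conjLocal L (IsCMField.complexConj L) v))) →
        IsQuadraticCharExtension (conjLocal L (IsCMField.complexConj L) v) χ₁ →
        ∀ c c' : IrrClass ((cmDatum L 2 (Matrix.of fun i j : Fin 2 => if i.val + j.val + 1 = 2 then (1 : L) else 0)).Local v),
          c.IsConstituentOf (cmPrincipalSeries L 2 v
            (torusCharPair (conjLocal L (IsCMField.complexConj L) v) (cmLocalForm L 2 v) (cmLocalForm_eq_over L 2 v) 0 χ₁ χ₂)) →
          c'.IsConstituentOf (cmPrincipalSeries L 2 v
            (torusCharPair (conjLocal L (IsCMField.complexConj L) v) (cmLocalForm L 2 v) (cmLocalForm_eq_over L 2 v) 0 χ₁ χ₂)) →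
          ∃ (T : GL (Fin 2) (LocalRing L v)) (a : LocalRing L v) (ha : IsUnit a)
            (h : formCongr (conjLocal L (IsCMField.complexConj L) v) T
              ((Matrix.of fun i j : Fin 2 => if i.val + j.val + 1 = 2 then (1 : L) else 0).map (algebraMap L (LocalRing L v))) =
              a • (Matrix.of fun i j : Fin 2 => if i.val + j.val + 1 = 2 then (1 : L) else 0).map (algebraMap L (LocalRing L v))),
            c' = IrrClass.comap (cmDatumLocalCongr L v T ha h) c) :
    ∀ (L : Type) [Field L] [NumberField L] [IsCMField L] (v : HeightOneSpectrum (𝓞 ↥(maximalRealSubfield L))),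
      (∀ w : PlacesOver L v, IsCMField.complexConj L • w.1 = w.1) →
      ∀ (χ₁ : (LocalRing L v)ˣ →* ℂˣ) (χ₂ : ↥(normOneUnits (conjLocal L (IsCMField.complexConj L) v)) →* ℂˣ),
        IsOpen ((χ₁.ker : Subgroup (LocalRing L v)ˣ) : Set (LocalRing L v)ˣ) →
        IsOpen ((χ₂.ker : Subgroup ↥(normOneUnits (conjLocal L (IsCMField.complexConj L) v))) :
          Set ↥(normOneUnits (conjLocal L (IsCMField.complexConj L) v))) →
        IsQuadraticCharExtension (conjLocal L (IsCMField.complexConj L) v) χ₁ →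
        ∃ O : Finset (IrrClass ((cmDatum L 2 (Matrix.of fun i j : Fin 2 => if i.val + j.val + 1 = 2 then (1 : L) else 0)).Local v)),
          (∃ σ : IrrClass ((cmDatum L 2 (Matrix.of fun i j : Fin 2 => if i.val + j.val + 1 = 2 then (1 : L) else 0)).Local v),
            σ.IsAdmissible ∧ ∀ c, c ∈ O ↔
              ∃ (T : GL (Fin 2) (LocalRing L v)) (a : LocalRing L v) (ha : IsUnit a)
                (h : formCongr (conjLocal L (IsCMField.complexConj L) v) T
                  ((Matrix.of fun i j : Fin 2 => if i.val + j.val + 1 = 2 then (1 : L) else 0).map (algebraMap L (LocalRing L v))) =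
                  a • (Matrix.of fun i j : Fin 2 => if i.val + j.val + 1 = 2 then (1 : L) else 0).map (algebraMap L (LocalRing L v))),
                c = IrrClass.comap (cmDatumLocalCongr L v T ha h) σ) ∧
          O.card = 2 ∧
          ∀ c : IrrClass ((cmDatum L 2 (Matrix.of fun i j : Fin 2 => if i.val + j.val + 1 = 2 then (1 : L) else 0)).Local v), c ∈ O ↔
            c.IsConstituentOf
              (cmPrincipalSeries L 2 v
                (torusCharPair (conjLocal L (IsCMField.complexConj L) v) (cmLocalForm L 2 v) (cmLocalForm_eq_over L 2 v) 0 χ₁ χ₂)) :=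
  stub_R90_S4_H_lds_of_two_of_orbit
    (fun L _ _ _ v hv χ₁ χ₂ hχ₁ hχ₂ hq => two_of_exists_sub_not_equiv_quot L v hv _ (hRed L v hv χ₁ χ₂ hχ₁ hχ₂ hq)) hOrbit

end Summit.HodgeConjecture.HodgeConjecture.R90.S4

end
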